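import Summits.BirchSwinnertonDyer.Rank1Residual.X4.KuriharaAdditiveCertificate
import Summits.BirchSwinnertonDyer.Rank1Residual.X4.KuriharaLevelLoweringModPowTwist
import HarnessLib

/-!
# The ADDITIVE (two-prime, `τ`-system) certificate TRANSPORTS along a quadratic twist: `PlusSymbolLevelLowersAdditivelyModAt W p f_W M ℓ₁ ℓ₂` from a `V`-side `τ`-system and the twist formula for the plus symbol (cell `b2b-bsdres`, seat additive-p4 gen 31, line V52-C; the twist-good SPREAD rows of CLASS-CLOSURE §3.1 N11, e.g. 298980j1)

HONEST FRAMING (verbatim, cell `b2b-bsdres`): the goal of the cell is to DELETE the COMBINATION-SHAPED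
residual classes for ALL analytic-rank `≤ 1` curves over `ℚ` — "full BSD formula for every rank `≤ 1`
curve in class `C`" assembled STRICTLY from published theorems — so that the rank-`≤ 1` remainder
becomes exactly the CONSTRUCTION-SHAPED classes, which are TYPED (missing-input Props), NOT attempted;
this is not "finishing BSD". This file: research-route KERNEL THEOREMS (pure algebra: transport of a
finite certificate along a character twist), 0 defs, 0 facts, nothing booked; X4 CONSTRUCTION-SHAPED.

## What is proved

Gen 22/29/30 transported the EIGEN certificates along a twist `f_W = f_V ⊗ χ` using that the twisted
sum `T_χμ(r) = ∑_{u mod m} χ(u) μ(r + u/m)` is periodic, multiplies Hecke EIGENVALUES by `χ(q)`, and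
sends an `ℓ`-old difference with sign `w` to one with sign `wχ(ℓ)`. The additive certificate is made of
NON-eigen functions, so one needs the operator statement behind `heckeRel_twistSum`:

* **`heckeTransform_twistSum`** — `H_q(T_χ μ) = χ(q) · T_χ(H_q μ)` for `μ` periodic, `q` invertible
  mod `m`, `χ(q)² = 1` (the two boundary terms `μ(qr + q²u/m)` and `μ(qr + u/m)` cancel after
  re-indexing).
* **`plusSymbolLevelLowersAdditivelyModAt_of_twistSum_fn`** (any modulus `M`): from `V`-side families
  `Dα, Dβ, τ` with Hecke-derivative relations of eigenvalues `e_q` (`χ(q)e_q = a_q(W)`), the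
  `τ`-identities with `V`'s signs `w₁, w₂` (`w_iχ(ℓ_i) = 1`), the `V`-side decomposition of `φ` and
  `\overline{[r]⁺_{f_W}} = c·T_χφ(r)`: the `W`-side certificate, with witnesses
  `D^W U = c·(∏_{q∈U} χ(q))·T_χ(D^V U)` (the factor `χ(U)` absorbs the `χ(q)` of each derivative).
* **`plusSymbolLevelLowersAdditivelyModAt_of_ratTwist`** (the cell's shape, modulus `p^e`): from a
  ℚ-LEVEL identity `[r]⁺_{f_W} = c₀·∑_u ε(u) σ(r + u/m)` with `p`-integral data and the `V`-side
  additive certificate data for `\overline{σ}` (eigenvalues `a_q(V)`, `a_q(W) = χ(q)a_q(V)`). Every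
  consequence of `X4/KuriharaAdditiveCertificate.lean` (`∂^{(∞)} ≥ e`) and the closures of
  `X4/KimDefectAdditiveLevelLowering.lean` then apply to `W` with a `τ`-system computed on `V`
  (instrument E9b `thjoint_twist`; EVIDENCE, never a fact). PARITY (gen 31 audit): `σ` here must have the parity of `χ` — for an ODD character (`D < 0`, e.g. `χ_{−3}`) `σ` is the MINUS symbol of `f_V` (tree: `exists_rat_forall_ratPlusSymbol_charTwist_eq_of_odd`), so the `V`-side data must be computed on the MINUS modular-symbol space of `V`; a certificate found on `V`'s PLUS space is one for `W`'s MINUS symbol and is NOT an input of this theorem. (The gen-30 run on the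
  SPREAD row 298980j1 at `p = 3`, primes `5, 11`, `N_V = 33 220` — joint `τ`-system found at
  `k = 2 = e₁ + e₂`, unique — was on the PLUS space of the `−3`-twist, i.e. the wrong parity for this
  theorem; the minus-space run is the cell's instrument record `llcertmulti_sign.gp`, prereg P-SIGN.)

## References

* B. Mazur, J. Tate, J. Teitelbaum, Invent. Math. 84 (1986), §I.4 (4.2), §I.8. [cite: MazurTateTeitelbaum1986Invent, §I.4 (4.2) and §I.8]
* G. Shimura, *Introduction to the arithmetic theory of automorphic functions* (1971), Prop. 3.64. [cite: Shimura1971, Prop. 3.64]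
* C.-H. Kim, Amer. J. Math. 148 (2026), §1.2.2, §1.4.3, Conj. 1.10. [cite: Kim2022StructureSelmer, §1.2.2 and §1.4.3]
-/

noncomputable section

open scoped MatrixGroups ModularForm

open CongruenceSubgroup Finset

open Literature.NumberTheory.EllipticCurves Literature.NumberTheory.EllipticCurves.ModularForms

open Literature.NumberTheory.DiophantineGeometry.Dioph (ratModP)

namespace Summit.BirchSwinnertonDyer.Rank1Residual.LevelLowering

/-! ### §1 The Hecke TRANSFORM of a twisted sum -/

section TwistAlgebra

variable {R : Type*} [CommRing R] {m : ℕ} [NeZero m] (χ : ZMod m →* R) {μ : ℚ → R}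

/-- **`H_q(T_χ μ) = χ(q) · T_χ(H_q μ)`**: the Hecke transform of the twisted sum of a periodic `μ`
(`q ≥ 1` invertible mod `m`, `χ(q)² = 1`) — the operator form of gen 22's `heckeRel_twistSum`
(`a_q(f ⊗ χ) = χ(q)a_q(f)`), valid for NON-eigen `μ`. [cite: MazurTateTeitelbaum1986Invent, §I.4 (4.2) and §I.8] -/
theorem heckeTransform_twistSum (hμ : IsPeriodic μ) {q : ℕ} (hq0 : q ≠ 0)
    (hq : IsUnit ((q : ℕ) : ZMod m)) (hχq : χ q ^ 2 = 1) (r : ℚ) :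
    heckeTransform q (fun s ↦ ∑ u : ZMod m, χ u * μ (s + (u.val : ℚ) / m)) r =
      χ q * ∑ u : ZMod m, χ u * heckeTransform q μ (r + (u.val : ℚ) / m) := by
  have hqQ : (q : ℚ) ≠ 0 := by exact_mod_cast hq0
  -- the Hecke transform of `μ` at the shifted points `r + q u/m`
  have hrow : ∀ u : ZMod m, ∑ j ∈ Finset.range q, μ ((r + j) / q + (u.val : ℚ) / m) =
      heckeTransform q μ (r + (q : ℚ) * u.val / m) - μ (q * r + ((q ^ 2 : ℕ) : ℚ) * u.val / m) := by
    intro u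
    have e1 : ∀ j : ℕ, (r + (q : ℚ) * u.val / m + j) / q = (r + j) / q + (u.val : ℚ) / m := by
      intro j; field_simp; ring
    have e2 : (q : ℚ) * (r + (q : ℚ) * u.val / m) = q * r + ((q ^ 2 : ℕ) : ℚ) * u.val / m := by
      push_cast; ring
    simp only [heckeTransform, e1, e2]
    ring
  have hperH : IsPeriodic (heckeTransform q μ) := hμ.heckeTransform' (Nat.pos_of_ne_zero hq0)
  have hunit2 : IsUnit (((q ^ 2 : ℕ) : ℕ) : ZMod m) := by
    rw [Nat.cast_pow]; exact hq.pow 2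
  have hχq2 : χ ((q ^ 2 : ℕ) : ZMod m) ^ 2 = 1 := by
    rw [Nat.cast_pow, map_pow, ← pow_mul, mul_comm, pow_mul, hχq, one_pow]
  have hχq2' : χ ((q ^ 2 : ℕ) : ZMod m) = 1 := by rw [Nat.cast_pow, map_pow, hχq]
  -- unfold the outer transform and exchange the sums
  show (∑ j ∈ Finset.range q, ∑ u : ZMod m, χ u * μ ((r + j) / q + (u.val : ℚ) / m)) +
      ∑ u : ZMod m, χ u * μ (q * r + (u.val : ℚ) / m) =
    χ q * ∑ u : ZMod m, χ u * heckeTransform q μ (r + (u.val : ℚ) / m)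
  rw [Finset.sum_comm]
  simp_rw [← Finset.mul_sum, hrow, mul_sub, Finset.sum_sub_distrib]
  have hA : ∑ u : ZMod m, χ u * heckeTransform q μ (r + (q : ℚ) * u.val / m) =
      χ q * ∑ u : ZMod m, χ u * heckeTransform q μ (r + (u.val : ℚ) / m) :=
    twistSum_natMul χ hperH hq hχq r
  have hB : ∑ u : ZMod m, χ u * μ (q * r + ((q ^ 2 : ℕ) : ℚ) * u.val / m) =
      ∑ u : ZMod m, χ u * μ (q * r + (u.val : ℚ) / m) := by
    rw [twistSum_natMul χ hμ hunit2 hχq2, hχq2', one_mul]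
  rw [hA, hB]
  ring

/-- Twisted sums are additive. [folklore] -/
theorem twistSum_add (μ ν : ℚ → R) (s : ℚ) :
    ∑ u : ZMod m, χ u * (μ (s + (u.val : ℚ) / m) + ν (s + (u.val : ℚ) / m)) =
      ∑ u : ZMod m, χ u * μ (s + (u.val : ℚ) / m) + ∑ u : ZMod m, χ u * ν (s + (u.val : ℚ) / m) := by
  rw [← Finset.sum_add_distrib]
  exact Finset.sum_congr rfl fun u _ ↦ mul_add _ _ _

/-- Twisted sums commute with scalars. [folklore] -/
theorem twistSum_const_mul (a : R) (μ : ℚ → R) (s : ℚ) :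
    ∑ u : ZMod m, χ u * (a * μ (s + (u.val : ℚ) / m)) =
      a * ∑ u : ZMod m, χ u * μ (s + (u.val : ℚ) / m) := by
  rw [Finset.mul_sum]
  exact Finset.sum_congr rfl fun u _ ↦ by ring

end TwistAlgebra

/-! ### §2 Transport of the additive certificate from `V`-side function data -/

section TransportFn

variable (W : WeierstrassCurve ℚ) [W.IsGloballyMinimal] (p : ℕ) {M : ℕ}
  {m : ℕ} [NeZero m] (χ : ZMod m →* ZMod M) {NW : ℕ} (fW : CuspForm (Gamma0 NW) 2)

/-- **TRANSPORT OF THE ADDITIVE MOD-`M` CERTIFICATE FROM A `V`-SIDE `τ`-SYSTEM.** Data: the reduced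
plus symbol of `f_W` is `c` times the `χ`-twisted sum of `φ : ℚ → ℤ/M` (`hsym`); `V`-side families
`Dα, Dβ, τ` (periodic) with the Hecke-derivative relations of eigenvalues `e_q` at the Kolyvagin
primes `q` of `(W, p)` (`q` invertible mod `m`, `χ(q)² = 1`, `χ(q)e_q = a_q(W) mod M`), the
`τ`-identities with `V`'s signs `Dα U = τ_U − w₂τ_U∘[ℓ₂]`, `Dβ U = −(τ_U − w₁τ_U∘[ℓ₁])` (`U ≠ ∅`), the
decomposition `φ = (Dα ∅ − w₁Dα ∅∘[ℓ₁]) + (Dβ ∅ − w₂Dβ ∅∘[ℓ₂])`, and `ℓ_i` invertible mod `m` with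
`χ(ℓ_i)² = 1`, `w_iχ(ℓ_i) = 1`. THEN `PlusSymbolLevelLowersAdditivelyModAt W p f_W M ℓ₁ ℓ₂`, with the
witnesses `D^W U = c·(∏_{q∈U}χ(q))·T_χ(D^V U)` (`heckeTransform_twistSum`: each derivative acquires a
`χ(q)`, absorbed by `χ(U)`; `twistSum_oldform`: the signs `w_i` become `w_iχ(ℓ_i) = 1`).
[cite: Kim2022StructureSelmer, §1.2.2 and §1.4.3] [cite: MazurTateTeitelbaum1986Invent, §I.4 (4.2) and §I.8] -/
theorem plusSymbolLevelLowersAdditivelyModAt_of_twistSum_fn (c : ZMod M) (φ : ℚ → ZMod M)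
    (hsym : ∀ r : ℚ, ratModP M (ratPlusSymbol fW r) =
      c * ∑ u : ZMod m, χ u * φ (r + (u.val : ℚ) / m))
    {ℓ₁ ℓ₂ : ℕ} (Dα Dβ τ : Finset ℕ → ℚ → ZMod M)
    (hpα : ∀ U, IsPeriodic (Dα U)) (hpβ : ∀ U, IsPeriodic (Dβ U)) (hpτ : ∀ U, IsPeriodic (τ U))
    (e : ℕ → ZMod M)
    (hq : ∀ q : ℕ, Kato.IsKolyvaginPrime W p 1 q →
      IsUnit ((q : ℕ) : ZMod m) ∧ χ q ^ 2 = 1 ∧ χ q * e q = (W.frobeniusTrace q : ZMod M))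
    (hDα : ∀ (U : Finset ℕ) (q : ℕ), Kato.IsKolyvaginPrime W p 1 q → q ∉ U → ∀ r : ℚ,
      heckeTransform q (Dα U) r = e q * Dα U r + Dα (insert q U) r)
    (hDβ : ∀ (U : Finset ℕ) (q : ℕ), Kato.IsKolyvaginPrime W p 1 q → q ∉ U → ∀ r : ℚ,
      heckeTransform q (Dβ U) r = e q * Dβ U r + Dβ (insert q U) r)
    (hDτ : ∀ (U : Finset ℕ), U.Nonempty → ∀ (q : ℕ), Kato.IsKolyvaginPrime W p 1 q → q ∉ U →
      ∀ r : ℚ, heckeTransform q (τ U) r = e q * τ U r + τ (insert q U) r)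
    {w₁ w₂ : ZMod M}
    (h1 : ∀ U : Finset ℕ, U.Nonempty → (∀ q ∈ U, Kato.IsKolyvaginPrime W p 1 q) →
      ∀ r : ℚ, Dα U r = τ U r - w₂ * τ U (ℓ₂ * r))
    (h2 : ∀ U : Finset ℕ, U.Nonempty → (∀ q ∈ U, Kato.IsKolyvaginPrime W p 1 q) →
      ∀ r : ℚ, Dβ U r = -(τ U r - w₁ * τ U (ℓ₁ * r)))
    (hV : ∀ r : ℚ, φ r = (Dα ∅ r - w₁ * Dα ∅ (ℓ₁ * r)) + (Dβ ∅ r - w₂ * Dβ ∅ (ℓ₂ * r)))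
    (hℓ₁ : IsUnit ((ℓ₁ : ℕ) : ZMod m) ∧ χ ℓ₁ ^ 2 = 1 ∧ w₁ * χ ℓ₁ = 1)
    (hℓ₂ : IsUnit ((ℓ₂ : ℕ) : ZMod m) ∧ χ ℓ₂ ^ 2 = 1 ∧ w₂ * χ ℓ₂ = 1) :
    PlusSymbolLevelLowersAdditivelyModAt W p fW M ℓ₁ ℓ₂ := by
  classical
  -- periodicity of the transported families `D^W U = c · χ(U) · T_χ(D^V U)`
  have hperT : ∀ D : Finset ℕ → ℚ → ZMod M, (∀ U, IsPeriodic (D U)) → ∀ U : Finset ℕ,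
      IsPeriodic (fun s ↦ c * (∏ q ∈ U, χ q) * ∑ u : ZMod m, χ u * D U (s + (u.val : ℚ) / m)) := by
    intro D hD U r z
    have hper := isPeriodic_twistSum χ (hD U) r z
    simp only at hper ⊢
    rw [hper]
  -- derivative relations of the transported families
  have hderT : ∀ (D : Finset ℕ → ℚ → ZMod M), (∀ U, IsPeriodic (D U)) →
      ∀ (U : Finset ℕ) (q : ℕ), Kato.IsKolyvaginPrime W p 1 q → q ∉ U →
      (∀ r : ℚ, heckeTransform q (D U) r = e q * D U r + D (insert q U) r) →
      ∀ r : ℚ, heckeTransform q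
          (fun s ↦ c * (∏ q' ∈ U, χ q') * ∑ u : ZMod m, χ u * D U (s + (u.val : ℚ) / m)) r =
        (W.frobeniusTrace q : ZMod M) *
            (c * (∏ q' ∈ U, χ q') * ∑ u : ZMod m, χ u * D U (r + (u.val : ℚ) / m)) +
          c * (∏ q' ∈ insert q U, χ q') *
            ∑ u : ZMod m, χ u * D (insert q U) (r + (u.val : ℚ) / m) := by
    intro D hD U q hKq hqU hrel r
    obtain ⟨hqu, hχq, haq⟩ := hq q hKq
    have hfun : (fun s ↦ c * (∏ q' ∈ U, χ q') * ∑ u : ZMod m, χ u * D U (s + (u.val : ℚ) / m)) =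
        fun s ↦ (c * ∏ q' ∈ U, χ q') *
          (fun s' ↦ ∑ u : ZMod m, χ u * D U (s' + (u.val : ℚ) / m)) s := by
      funext s; ring
    have hsum : ∑ u : ZMod m, χ u * heckeTransform q (D U) (r + (u.val : ℚ) / m) =
        e q * ∑ u : ZMod m, χ u * D U (r + (u.val : ℚ) / m) +
          ∑ u : ZMod m, χ u * D (insert q U) (r + (u.val : ℚ) / m) := by
      rw [Finset.mul_sum, ← Finset.sum_add_distrib]
      exact Finset.sum_congr rfl fun u _ ↦ by rw [hrel]; ring
    rw [hfun, heckeTransform_const_mul,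
      heckeTransform_twistSum χ (hD U) hKq.prime.ne_zero hqu hχq r, hsum,
      Finset.prod_insert hqU, ← haq]
    ring
  refine ⟨fun U s ↦ c * (∏ q ∈ U, χ q) * ∑ u : ZMod m, χ u * Dα U (s + (u.val : ℚ) / m),
    fun U s ↦ c * (∏ q ∈ U, χ q) * ∑ u : ZMod m, χ u * Dβ U (s + (u.val : ℚ) / m),
    fun U s ↦ c * (∏ q ∈ U, χ q) * ∑ u : ZMod m, χ u * τ U (s + (u.val : ℚ) / m),
    hperT Dα hpα, hperT Dβ hpβ, hperT τ hpτ,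
    fun U q hKq hqU ↦ hderT Dα hpα U q hKq hqU (hDα U q hKq hqU),
    fun U q hKq hqU ↦ hderT Dβ hpβ U q hKq hqU (hDβ U q hKq hqU),
    fun U hU q hKq hqU ↦ hderT τ hpτ U q hKq hqU (hDτ U hU q hKq hqU), ?_, ?_, ?_⟩
  · -- `Dα^W U = τ^W_U − τ^W_U∘[ℓ₂]`
    intro U hU hUK r
    obtain ⟨hu2, hχ2, hw2⟩ := hℓ₂
    have h := twistSum_oldform χ (hpτ U) (φ := Dα U) hu2 hχ2 (h1 U hU hUK) r
    simp only
    rw [h, hw2, one_mul]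
    ring
  · -- `Dβ^W U = −(τ^W_U − τ^W_U∘[ℓ₁])`
    intro U hU hUK r
    obtain ⟨hu1, hχ1, hw1⟩ := hℓ₁
    have hneg : ∀ s : ℚ, (fun x ↦ -Dβ U x) s = τ U s - w₁ * τ U (ℓ₁ * s) := by
      intro s; simp only [h2 U hU hUK s, neg_neg]
    have h := twistSum_oldform χ (hpτ U) (φ := fun x ↦ -Dβ U x) hu1 hχ1 hneg r
    have hlin : ∑ u : ZMod m, χ u * (fun x ↦ -Dβ U x) (r + (u.val : ℚ) / m) =
        -∑ u : ZMod m, χ u * Dβ U (r + (u.val : ℚ) / m) := by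
      rw [← Finset.sum_neg_distrib]
      exact Finset.sum_congr rfl fun u _ ↦ by simp only [mul_neg]
    rw [hlin, hw1, one_mul] at h
    have h' : ∑ u : ZMod m, χ u * Dβ U (r + (u.val : ℚ) / m) =
        -(∑ u : ZMod m, χ u * τ U (r + (u.val : ℚ) / m) -
          ∑ u : ZMod m, χ u * τ U (ℓ₁ * r + (u.val : ℚ) / m)) := by
      rw [← h, neg_neg]
    simp only
    rw [h']
    ring
  · -- the decomposition of the plus symbol of `f_W`
    intro r
    obtain ⟨hu1, hχ1, hw1⟩ := hℓ₁
    obtain ⟨hu2, hχ2, hw2⟩ := hℓ₂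
    have hA := twistSum_oldform χ (hpα ∅) (φ := fun x ↦ Dα ∅ x - w₁ * Dα ∅ (ℓ₁ * x)) hu1 hχ1
      (fun _ ↦ rfl) r
    have hB := twistSum_oldform χ (hpβ ∅) (φ := fun x ↦ Dβ ∅ x - w₂ * Dβ ∅ (ℓ₂ * x)) hu2 hχ2
      (fun _ ↦ rfl) r
    have hsum : ∑ u : ZMod m, χ u * φ (r + (u.val : ℚ) / m) =
        ∑ u : ZMod m, χ u * (Dα ∅ (r + (u.val : ℚ) / m) - w₁ * Dα ∅ (ℓ₁ * (r + (u.val : ℚ) / m))) +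
          ∑ u : ZMod m, χ u * (Dβ ∅ (r + (u.val : ℚ) / m) - w₂ * Dβ ∅ (ℓ₂ * (r + (u.val : ℚ) / m))) := by
      rw [← Finset.sum_add_distrib]
      exact Finset.sum_congr rfl fun u _ ↦ by rw [hV]; ring
    simp only [Finset.prod_empty]
    rw [hsym r, hsum, hA, hB, hw1, hw2]
    ring

end TransportFn

/-! ### §3 The cell's shape at the modulus `p^e`: from a ℚ-level twist identity with `p`-integral data -/

section RatTwist

variable {p : ℕ} [hp : Fact p.Prime]

/-- `ratModP (p^k)` is multiplicative on `p`-integral rationals. [folklore] -/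
private theorem ratModP_pow_mul_of_not_dvd'' (k : ℕ) {a b : ℚ} (ha : ¬ p ∣ a.den)
    (hb : ¬ p ∣ b.den) :
    ratModP (p ^ k) (a * b) = ratModP (p ^ k) a * ratModP (p ^ k) b := by
  have hab : ¬ p ∣ (a * b).den := fun hd ↦ by
    rcases (Nat.Prime.dvd_mul hp.out).mp (hd.trans (Rat.mul_den_dvd a b)) with h | h
    exacts [ha h, hb h]
  rw [ratModP_eq_toZModPow p k ha, ratModP_eq_toZModPow p k hb, ratModP_eq_toZModPow p k hab,
    ← map_mul]
  congr 1

/-- `ratModP (p^k)` is additive on `p`-integral rationals, and sums of `p`-integral rationals are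
`p`-integral. [folklore] -/
private theorem ratModP_pow_sum_of_not_dvd'' (k : ℕ) {ι : Type*} (s : Finset ι) (g : ι → ℚ)
    (h : ∀ i ∈ s, ¬ p ∣ (g i).den) :
    ¬ p ∣ (∑ i ∈ s, g i).den ∧
      ratModP (p ^ k) (∑ i ∈ s, g i) = ∑ i ∈ s, ratModP (p ^ k) (g i) := by
  classical
  induction s using Finset.induction_on with
  | empty => simp [hp.out.one_lt.ne']
  | insert a s has ih =>
    have ha : ¬ p ∣ (g a).den := h a (Finset.mem_insert_self a s)
    obtain ⟨hs, hcast⟩ := ih fun i hi ↦ h i (Finset.mem_insert_of_mem hi)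
    rw [Finset.sum_insert has, Finset.sum_insert has]
    have hsum : ¬ p ∣ (g a + ∑ i ∈ s, g i).den := fun hd ↦ by
      rcases (Nat.Prime.dvd_mul hp.out).mp (hd.trans (Rat.add_den_dvd (g a) (∑ i ∈ s, g i)))
        with h1 | h1
      exacts [ha h1, hs h1]
    refine ⟨hsum, ?_⟩
    rw [ratModP_eq_toZModPow p k hsum, ratModP_eq_toZModPow p k ha, ← hcast,
      ratModP_eq_toZModPow p k hs, ← map_add]
    congr 1

/-- **THE CELL'S ADDITIVE TRANSPORT AT THE MODULUS `p^e`.** Data: curves `W` (the pair's curve) and `V`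
(its twist), cusp form `f_W`, a `V`-side symbol function `σ : ℚ → ℚ` (the plus OR the minus rational
symbol of `f_V`), an integer-valued `ε : ℤ/m → ℤ` reducing to `χ : ℤ/m →* ℤ/p^e` (`hε`), the ℚ-LEVEL
twist identity `[r]⁺_{f_W} = c₀ · ∑_{u mod m} ε(u) σ(r + u/m)` (`hsym`) with `p ∤ den c₀` (`hc`) and
`σ` `p`-integral (`hint`); on the `V` side, the ADDITIVE mod-`p^e` data for `\overline{σ}`: families
`Dα, Dβ, τ` (periodic; Hecke-derivative relations of eigenvalues `a_q(V)` at the Kolyvagin primes of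
`(W, p)`; `τ`-identities with signs `w₁, w₂`; decomposition of `\overline{σ}`) — the per-pair joint
`τ`-certificate computed on `V` — and `ℓ_i`, `q` invertible mod `m` with `χ² = 1`, `w_iχ(ℓ_i) = 1`,
`a_q(W) = χ(q)a_q(V)` (`haq`). Conclusion: `PlusSymbolLevelLowersAdditivelyModAt W p f_W (p^e) ℓ₁ ℓ₂`,
so `∂^{(∞)} ≥ e` for `W` (`le_kuriharaPartialInfty_of_plusSymbolLevelLowersAdditivelyModAt`).
[cite: Kim2022StructureSelmer, §1.2.2 and §1.4.3] [cite: MazurTateTeitelbaum1986Invent, §I.4 (4.2) and §I.8]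
[cite: Shimura1971, Prop. 3.64] -/
theorem plusSymbolLevelLowersAdditivelyModAt_of_ratTwist (W V : WeierstrassCurve ℚ)
    [W.IsGloballyMinimal] [V.IsGloballyMinimal] {e : ℕ} {m : ℕ} [NeZero m]
    (χ : ZMod m →* ZMod (p ^ e)) (ε : ZMod m → ℤ)
    (hε : ∀ u : ZMod m, ((ε u : ℤ) : ZMod (p ^ e)) = χ u)
    {NW : ℕ} (fW : CuspForm (Gamma0 NW) 2) (σ : ℚ → ℚ)
    (c₀ : ℚ) (hc : ¬ p ∣ c₀.den) (hint : ∀ x : ℚ, ¬ p ∣ (σ x).den)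
    (hsym : ∀ r : ℚ, ratPlusSymbol fW r =
      c₀ * ∑ u : ZMod m, (ε u : ℚ) * σ (r + (u.val : ℚ) / m))
    {ℓ₁ ℓ₂ : ℕ} (Dα Dβ τ : Finset ℕ → ℚ → ZMod (p ^ e))
    (hpα : ∀ U, IsPeriodic (Dα U)) (hpβ : ∀ U, IsPeriodic (Dβ U)) (hpτ : ∀ U, IsPeriodic (τ U))
    (hDα : ∀ (U : Finset ℕ) (q : ℕ), Kato.IsKolyvaginPrime W p 1 q → q ∉ U → ∀ r : ℚ,
      heckeTransform q (Dα U) r = (V.frobeniusTrace q : ZMod (p ^ e)) * Dα U r + Dα (insert q U) r)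
    (hDβ : ∀ (U : Finset ℕ) (q : ℕ), Kato.IsKolyvaginPrime W p 1 q → q ∉ U → ∀ r : ℚ,
      heckeTransform q (Dβ U) r = (V.frobeniusTrace q : ZMod (p ^ e)) * Dβ U r + Dβ (insert q U) r)
    (hDτ : ∀ (U : Finset ℕ), U.Nonempty → ∀ (q : ℕ), Kato.IsKolyvaginPrime W p 1 q → q ∉ U →
      ∀ r : ℚ, heckeTransform q (τ U) r =
        (V.frobeniusTrace q : ZMod (p ^ e)) * τ U r + τ (insert q U) r)
    {w₁ w₂ : ZMod (p ^ e)}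
    (h1 : ∀ U : Finset ℕ, U.Nonempty → (∀ q ∈ U, Kato.IsKolyvaginPrime W p 1 q) →
      ∀ r : ℚ, Dα U r = τ U r - w₂ * τ U (ℓ₂ * r))
    (h2 : ∀ U : Finset ℕ, U.Nonempty → (∀ q ∈ U, Kato.IsKolyvaginPrime W p 1 q) →
      ∀ r : ℚ, Dβ U r = -(τ U r - w₁ * τ U (ℓ₁ * r)))
    (hV : ∀ r : ℚ, ratModP (p ^ e) (σ r) =
      (Dα ∅ r - w₁ * Dα ∅ (ℓ₁ * r)) + (Dβ ∅ r - w₂ * Dβ ∅ (ℓ₂ * r)))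
    (hℓ₁ : IsUnit ((ℓ₁ : ℕ) : ZMod m) ∧ χ ℓ₁ ^ 2 = 1 ∧ w₁ * χ ℓ₁ = 1)
    (hℓ₂ : IsUnit ((ℓ₂ : ℕ) : ZMod m) ∧ χ ℓ₂ ^ 2 = 1 ∧ w₂ * χ ℓ₂ = 1)
    (hunit : ∀ q : ℕ, Kato.IsKolyvaginPrime W p 1 q → IsUnit ((q : ℕ) : ZMod m) ∧ χ q ^ 2 = 1)
    (haq : ∀ q : ℕ, Kato.IsKolyvaginPrime W p 1 q →
      (W.frobeniusTrace q : ZMod (p ^ e)) = χ q * V.frobeniusTrace q) :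
    PlusSymbolLevelLowersAdditivelyModAt W p fW (p ^ e) ℓ₁ ℓ₂ := by
  -- the mod-`p^e` twist identity
  have hsymP : ∀ r : ℚ, ratModP (p ^ e) (ratPlusSymbol fW r) =
      ratModP (p ^ e) c₀ * ∑ u : ZMod m, χ u * ratModP (p ^ e) (σ (r + (u.val : ℚ) / m)) := by
    intro r
    have hterm : ∀ u ∈ (Finset.univ : Finset (ZMod m)),
        ¬ p ∣ ((ε u : ℚ) * σ (r + (u.val : ℚ) / m)).den := by
      intro u _ hd
      have := hd.trans (Rat.mul_den_dvd _ _)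
      rw [Rat.den_intCast, one_mul] at this
      exact hint _ this
    obtain ⟨hden, hcast⟩ := ratModP_pow_sum_of_not_dvd'' (p := p) e Finset.univ _ hterm
    rw [hsym r, ratModP_pow_mul_of_not_dvd'' e hc hden, hcast]
    congr 1
    refine Finset.sum_congr rfl fun u _ ↦ ?_
    have hεu : ¬ p ∣ ((ε u : ℤ) : ℚ).den := by
      rw [Rat.den_intCast]; exact hp.out.one_lt.ne' ∘ Nat.dvd_one.mp
    rw [ratModP_pow_mul_of_not_dvd'' e hεu (hint _), ratModP_intCast, hε u]
  refine plusSymbolLevelLowersAdditivelyModAt_of_twistSum_fn W p χ fW (ratModP (p ^ e) c₀)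
    (fun x ↦ ratModP (p ^ e) (σ x)) hsymP Dα Dβ τ hpα hpβ hpτ
    (fun q ↦ χ q * (W.frobeniusTrace q : ZMod (p ^ e))) (fun q hKq ↦ ?_) ?_ ?_ ?_ h1 h2 hV hℓ₁ hℓ₂
  · obtain ⟨hqu, hχq⟩ := hunit q hKq
    exact ⟨hqu, hχq, by rw [← mul_assoc, ← sq, hχq, one_mul]⟩
  · -- `χ(q) a_q(W) = χ(q)² a_q(V) = a_q(V)`
    intro U q hKq hqU r
    have : χ q * (W.frobeniusTrace q : ZMod (p ^ e)) = (V.frobeniusTrace q : ZMod (p ^ e)) := by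
      rw [haq q hKq, ← mul_assoc, ← sq, (hunit q hKq).2, one_mul]
    rw [this]
    exact hDα U q hKq hqU r
  · intro U q hKq hqU r
    have : χ q * (W.frobeniusTrace q : ZMod (p ^ e)) = (V.frobeniusTrace q : ZMod (p ^ e)) := by
      rw [haq q hKq, ← mul_assoc, ← sq, (hunit q hKq).2, one_mul]
    rw [this]
    exact hDβ U q hKq hqU r
  · intro U hU q hKq hqU r
    have : χ q * (W.frobeniusTrace q : ZMod (p ^ e)) = (V.frobeniusTrace q : ZMod (p ^ e)) := by
      rw [haq q hKq, ← mul_assoc, ← sq, (hunit q hKq).2, one_mul]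
    rw [this]
    exact hDτ U hU q hKq hqU r

end RatTwist

end Summit.BirchSwinnertonDyer.Rank1Residual.LevelLowering

end
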